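import Summits.QuantumFields.YangMills.Theorems.BalabanStepParabolic.Negative.TorusAction

/-!
# `BalabanStepParabolic` — negative-side support VI: the torus Wilson state as a Gibbs reweighting; `⟨S_W⟩_β → 0`

Part 2 of 3 of finite-torus regularity (crux `stmt-QuantumFields-9684`, disprover's work file §E). Tree objects only.

* `haarPi`, `Zr` (real partition function), `integral_wilsonMeasure_eq`: `∫ F dμ_β = Z(β)⁻¹ ∫ e^{−βS_W} F dHaar`;
  `Zr_pos`, `continuous_Zr`, `continuous_laplaceNum`, `continuous_integral_wilsonMeasure`: torus Wilson expectations
  of bounded measurable observables are continuous in `β ∈ ℝ` (dominated convergence).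
* `haarPi_actionLT_pos` (`Haar{S_W < t} > 0`: contains the trivial configuration), `expect_wilsonAction_le`
  (Laplace bound `⟨S_W⟩_β ≤ ε/2 + (B/Haar{S_W<ε/4}) e^{−βε/4}`), **`tendsto_expect_wilsonAction`**: `⟨S_W⟩_β → 0`.
-/

namespace Summit.QuantumFields.YangMills.Theorems.BalabanStepParabolic.Negative

open scoped SchwartzMap
open MeasureTheory Filter Topology
open Literature.MathematicalPhysics.QuantumFieldTheory Literature.MathematicalPhysics.AQFT
open Literature.MathematicalPhysics.QuantumLattice
open Literature.Probability.LatticeModels (box Torus.proj Torus.proj_apply)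

noncomputable section

section TorusGibbs

variable {G : Type} [Group G] [TopologicalSpace G] [IsTopologicalGroup G] [CompactSpace G]
  [MeasurableSpace G] [BorelSpace G] (r : LatticeRep G)

/-! #### The torus Wilson state as a Gibbs reweighting of product Haar measure -/

variable (T : ℕ) [NeZero T]

/-- Product Haar probability measure on torus configurations. -/
def haarPi : Measure (GaugeConfig 4 T G) := Measure.pi fun _ : Edge 4 T => haarProbability G

/-- Product Haar measure is a probability measure. [folklore] -/
instance isProbabilityMeasure_haarPi : IsProbabilityMeasure (haarPi (G := G) T) := by
  unfold haarPi; infer_instance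

/-- The real partition function `Z(β) = ∫ e^{-β S_W} dHaar`. -/
def Zr (β : ℝ) : ℝ := ∫ U, Real.exp (-β * wilsonAction r.ρ U) ∂(haarPi T)

/-- The Boltzmann factor is measurable. [folklore] -/
theorem measurable_expAction (β : ℝ) :
    Measurable fun U : GaugeConfig 4 T G => Real.exp (-β * wilsonAction r.ρ U) := by
  haveI := secondCountable_of_latticeRep r
  exact Real.measurable_exp.comp ((measurable_wilsonAction r.ρ r.continuous).const_mul _)

omit [IsTopologicalGroup G] [MeasurableSpace G] [BorelSpace G] in
/-- Two-sided bounds on the Boltzmann factor. [folklore] -/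
theorem exists_exp_action_bounds :
    ∃ B : ℝ, 0 ≤ B ∧ ∀ (β : ℝ) (U : GaugeConfig 4 T G),
      Real.exp (-(|β| * B)) ≤ Real.exp (-β * wilsonAction r.ρ U) ∧
        Real.exp (-β * wilsonAction r.ρ U) ≤ Real.exp (|β| * B) := by
  obtain ⟨B, hB⟩ := exists_abs_wilsonAction_le (d := 4) (L := T) r.ρ r.continuous
  have hB0 : 0 ≤ B := (abs_nonneg _).trans (hB 1)
  refine ⟨B, hB0, fun β U => ?_⟩
  have h : |β * wilsonAction r.ρ U| ≤ |β| * B := by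
    rw [abs_mul]; exact mul_le_mul_of_nonneg_left (hB U) (abs_nonneg _)
  have h1 := (abs_le.1 h).1
  have h2 := (abs_le.1 h).2
  exact ⟨Real.exp_le_exp.2 (by linarith), Real.exp_le_exp.2 (by linarith)⟩

/-- `Z(β) > 0`. [folklore] -/
theorem Zr_pos (β : ℝ) : 0 < Zr r T β := by
  obtain ⟨B, -, hB⟩ := exists_exp_action_bounds r T
  have hint : Integrable (fun U : GaugeConfig 4 T G => Real.exp (-β * wilsonAction r.ρ U)) (haarPi T) :=
    Integrable.of_bound (measurable_expAction r T β).aestronglyMeasurable (Real.exp (|β| * B))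
      (ae_of_all _ fun U => by rw [Real.norm_eq_abs, abs_of_pos (Real.exp_pos _)]; exact (hB β U).2)
  have hle : ∫ _U : GaugeConfig 4 T G, Real.exp (-(|β| * B)) ∂(haarPi T) ≤ Zr r T β :=
    integral_mono (integrable_const _) hint fun U => (hB β U).1
  rw [integral_const, probReal_univ, one_smul] at hle
  exact (Real.exp_pos _).trans_le hle

/-- **Gibbs reweighting formula**: torus Wilson expectations are product-Haar integrals against
the Boltzmann factor, divided by `Z(β)`. [folklore] -/
theorem integral_wilsonMeasure_eq (β : ℝ) (F : GaugeConfig 4 T G → ℝ) :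
    ∫ U, F U ∂(wilsonMeasure (d := 4) (L := T) r.ρ β) =
      (Zr r T β)⁻¹ * ∫ U, Real.exp (-β * wilsonAction r.ρ U) * F U ∂(haarPi T) := by
  have hw : Measurable fun U : GaugeConfig 4 T G =>
      ENNReal.ofReal (Real.exp (-β * wilsonAction r.ρ U)) := (measurable_expAction r T β).ennreal_ofReal
  obtain ⟨B, -, hB⟩ := exists_exp_action_bounds r T
  have hint : Integrable (fun U : GaugeConfig 4 T G => Real.exp (-β * wilsonAction r.ρ U)) (haarPi T) :=
    Integrable.of_bound (measurable_expAction r T β).aestronglyMeasurable (Real.exp (|β| * B))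
      (ae_of_all _ fun U => by rw [Real.norm_eq_abs, abs_of_pos (Real.exp_pos _)]; exact (hB β U).2)
  have hZ : partitionFunction (d := 4) (L := T) r.ρ β = ENNReal.ofReal (Zr r T β) := by
    rw [Zr, ofReal_integral_eq_lintegral_ofReal hint (ae_of_all _ fun U => (Real.exp_pos _).le)]
    simp only [partitionFunction, wilsonWeight, withDensity_apply _ MeasurableSet.univ,
      Measure.restrict_univ]
    rfl
  simp only [wilsonMeasure, integral_smul_measure, wilsonWeight, smul_eq_mul]
  rw [integral_withDensity_eq_integral_toReal_smul hw (ae_of_all _ fun U => ENNReal.ofReal_lt_top),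
    hZ, ENNReal.toReal_inv, ENNReal.toReal_ofReal (Zr_pos r T β).le]
  congr 1
  refine integral_congr_ae (ae_of_all _ fun U => ?_)
  simp only [smul_eq_mul]
  rw [ENNReal.toReal_ofReal (Real.exp_pos _).le]

/-- **Continuity in `β` of Boltzmann-weighted Haar integrals** of a bounded measurable
observable (dominated convergence). [folklore] -/
theorem continuous_laplaceNum (F : GaugeConfig 4 T G → ℝ) (hFm : Measurable F) {C : ℝ}
    (hC : ∀ U, |F U| ≤ C) :
    Continuous fun β : ℝ => ∫ U, Real.exp (-β * wilsonAction r.ρ U) * F U ∂(haarPi T) := by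
  obtain ⟨B, hB0, hB⟩ := exists_exp_action_bounds r T
  refine continuous_iff_continuousAt.2 fun β₀ => ?_
  refine continuousAt_of_dominated (bound := fun _ => Real.exp ((|β₀| + 1) * B) * C) ?_ ?_
    (integrable_const _) ?_
  · exact Eventually.of_forall fun β => ((measurable_expAction r T β).mul hFm).aestronglyMeasurable
  · filter_upwards [Metric.ball_mem_nhds β₀ one_pos] with β hβ
    refine ae_of_all _ fun U => ?_
    rw [Real.norm_eq_abs, abs_mul, abs_of_pos (Real.exp_pos _)]
    have hβ' : |β| ≤ |β₀| + 1 := by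
      have := Metric.mem_ball.1 hβ
      rw [Real.dist_eq] at this
      have := abs_sub_abs_le_abs_sub β β₀
      linarith
    have h1 : Real.exp (-β * wilsonAction r.ρ U) ≤ Real.exp ((|β₀| + 1) * B) :=
      (hB β U).2.trans (Real.exp_le_exp.2 (mul_le_mul_of_nonneg_right hβ' hB0))
    exact mul_le_mul h1 (hC U) (abs_nonneg _) (Real.exp_pos _).le
  · exact ae_of_all _ fun U => (by fun_prop : Continuous fun β : ℝ =>
      Real.exp (-β * wilsonAction r.ρ U) * F U).continuousAt

/-- `Z` is continuous. [folklore] -/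
theorem continuous_Zr : Continuous (Zr r T) := by
  have h := continuous_laplaceNum r T (fun _ => (1 : ℝ)) measurable_const (C := 1) (fun _ => by simp)
  simp only [mul_one] at h
  exact h

/-- **Continuity in `β` of torus Wilson expectations** of a bounded measurable observable. [folklore] -/
theorem continuous_integral_wilsonMeasure (F : GaugeConfig 4 T G → ℝ) (hFm : Measurable F) {C : ℝ}
    (hC : ∀ U, |F U| ≤ C) :
    Continuous fun β : ℝ => ∫ U, F U ∂(wilsonMeasure (d := 4) (L := T) r.ρ β) := by
  simp_rw [integral_wilsonMeasure_eq r T]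
  exact ((continuous_Zr r T).inv₀ fun β => (Zr_pos r T β).ne').mul
    (continuous_laplaceNum r T F hFm hC)

/-! #### Laplace concentration: `⟨S_W⟩_β → 0` as `β → ∞` -/

/-- Product Haar measure charges the open set `{S_W < t}` (it contains the trivial configuration). [folklore] -/
theorem haarPi_actionLT_pos {t : ℝ} (ht : 0 < t) :
    0 < ((haarPi (G := G) T) {U | wilsonAction r.ρ U < t}).toReal := by
  have hopen : IsOpen {U : GaugeConfig 4 T G | wilsonAction r.ρ U < t} :=
    isOpen_lt (continuous_wilsonAction (d := 4) (L := T) r.ρ r.continuous) continuous_const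
  have hne : ({U : GaugeConfig 4 T G | wilsonAction r.ρ U < t}).Nonempty :=
    ⟨1, by simp only [Set.mem_setOf_eq, wilsonAction_one]; exact ht⟩
  haveI : (haarPi (G := G) T).IsOpenPosMeasure := by unfold haarPi; infer_instance
  have hpos := hopen.measure_pos (haarPi (G := G) T) hne
  exact ENNReal.toReal_pos hpos.ne' (measure_ne_top _ _)

/-- **Laplace bound.** For `β ≥ 0` and `ε > 0`:
`⟨S_W⟩_β ≤ ε/2 + (B / Haar{S_W < ε/4}) · e^{−βε/4}`. [folklore] -/
theorem expect_wilsonAction_le {β ε : ℝ} (hβ : 0 ≤ β) (hε : 0 < ε) :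
    ∫ U, wilsonAction r.ρ U ∂(wilsonMeasure (d := 4) (L := T) r.ρ β) ≤
      ε / 2 + (Classical.choose (exists_abs_wilsonAction_le (d := 4) (L := T) r.ρ r.continuous) /
        ((haarPi (G := G) T) {U | wilsonAction r.ρ U < ε / 4}).toReal) * Real.exp (-(β * (ε / 4))) := by
  haveI := secondCountable_of_latticeRep r
  set B := Classical.choose (exists_abs_wilsonAction_le (d := 4) (L := T) r.ρ r.continuous) with hBdef
  have hB : ∀ U : GaugeConfig 4 T G, |wilsonAction r.ρ U| ≤ B :=
    Classical.choose_spec (exists_abs_wilsonAction_le (d := 4) (L := T) r.ρ r.continuous)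
  set q := ((haarPi (G := G) T) {U | wilsonAction r.ρ U < ε / 4}).toReal with hqdef
  have hq : 0 < q := haarPi_actionLT_pos r T (by positivity)
  have hSm : Measurable (wilsonAction (d := 4) (L := T) (G := G) r.ρ) := measurable_wilsonAction r.ρ r.continuous
  have hS0 : ∀ U : GaugeConfig 4 T G, 0 ≤ wilsonAction r.ρ U := wilsonAction_nonneg' r
  have hinte : Integrable (fun U : GaugeConfig 4 T G => Real.exp (-β * wilsonAction r.ρ U)) (haarPi T) :=
    Integrable.of_bound (measurable_expAction r T β).aestronglyMeasurable 1
      (ae_of_all _ fun U => by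
        rw [Real.norm_eq_abs, abs_of_pos (Real.exp_pos _), ← Real.exp_zero]
        exact Real.exp_le_exp.2 (by nlinarith [hS0 U]))
  -- numerator bound
  have hnum : ∫ U, Real.exp (-β * wilsonAction r.ρ U) * wilsonAction r.ρ U ∂(haarPi T) ≤
      ε / 2 * Zr r T β + B * Real.exp (-(β * (ε / 2))) := by
    have hpt : ∀ U : GaugeConfig 4 T G, Real.exp (-β * wilsonAction r.ρ U) * wilsonAction r.ρ U ≤
        ε / 2 * Real.exp (-β * wilsonAction r.ρ U) + B * Real.exp (-(β * (ε / 2))) := by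
      intro U
      have he := Real.exp_pos (-β * wilsonAction r.ρ U)
      have hBU : wilsonAction r.ρ U ≤ B := (le_abs_self _).trans (hB U)
      have hB0 : 0 ≤ B := (hS0 U).trans hBU
      by_cases hcase : wilsonAction r.ρ U ≤ ε / 2
      · have : Real.exp (-β * wilsonAction r.ρ U) * wilsonAction r.ρ U ≤
            ε / 2 * Real.exp (-β * wilsonAction r.ρ U) := by nlinarith
        have : 0 ≤ B * Real.exp (-(β * (ε / 2))) := by positivity
        linarith
      · have hcase' := not_le.1 hcase
        have hexp : Real.exp (-β * wilsonAction r.ρ U) ≤ Real.exp (-(β * (ε / 2))) :=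
          Real.exp_le_exp.2 (by nlinarith)
        have : Real.exp (-β * wilsonAction r.ρ U) * wilsonAction r.ρ U ≤ Real.exp (-(β * (ε / 2))) * B :=
          mul_le_mul hexp hBU (hS0 U) (Real.exp_pos _).le
        have : 0 ≤ ε / 2 * Real.exp (-β * wilsonAction r.ρ U) := by positivity
        linarith
    have hint1 : Integrable (fun U : GaugeConfig 4 T G => Real.exp (-β * wilsonAction r.ρ U) * wilsonAction r.ρ U)
        (haarPi T) := by
      refine Integrable.of_bound ((measurable_expAction r T β).mul hSm).aestronglyMeasurable (1 * B)
        (ae_of_all _ fun U => ?_)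
      rw [Real.norm_eq_abs, abs_mul, abs_of_pos (Real.exp_pos _)]
      refine mul_le_mul ?_ (hB U) (abs_nonneg _) zero_le_one
      rw [← Real.exp_zero]; exact Real.exp_le_exp.2 (by nlinarith [hS0 U])
    have hint2 : Integrable (fun U : GaugeConfig 4 T G =>
        ε / 2 * Real.exp (-β * wilsonAction r.ρ U) + B * Real.exp (-(β * (ε / 2)))) (haarPi T) :=
      (hinte.const_mul _).add (integrable_const _)
    calc _ ≤ ∫ U, (ε / 2 * Real.exp (-β * wilsonAction r.ρ U) + B * Real.exp (-(β * (ε / 2)))) ∂(haarPi T) :=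
          integral_mono hint1 hint2 hpt
      _ = ε / 2 * Zr r T β + B * Real.exp (-(β * (ε / 2))) := by
          rw [integral_add (hinte.const_mul _) (integrable_const _), integral_const_mul, integral_const,
            probReal_univ, one_smul, Zr]
  -- denominator bound
  have hden : Real.exp (-(β * (ε / 4))) * q ≤ Zr r T β := by
    have hpt : ∀ U : GaugeConfig 4 T G,
        Set.indicator {U | wilsonAction r.ρ U < ε / 4} (fun _ => Real.exp (-(β * (ε / 4)))) U ≤
          Real.exp (-β * wilsonAction r.ρ U) := by
      intro U
      by_cases hU : U ∈ {U : GaugeConfig 4 T G | wilsonAction r.ρ U < ε / 4}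
      · rw [Set.indicator_of_mem hU]
        exact Real.exp_le_exp.2 (by have := hU.out; nlinarith)
      · rw [Set.indicator_of_notMem hU]; exact (Real.exp_pos _).le
    have hmeas : MeasurableSet {U : GaugeConfig 4 T G | wilsonAction r.ρ U < ε / 4} :=
      measurableSet_lt hSm measurable_const
    have h := integral_mono ((integrable_const _).indicator hmeas) hinte hpt
    rw [integral_indicator hmeas, setIntegral_const, smul_eq_mul] at h
    calc Real.exp (-(β * (ε / 4))) * q
        = (haarPi T).real {U | wilsonAction r.ρ U < ε / 4} * Real.exp (-(β * (ε / 4))) := by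
          rw [hqdef, measureReal_def, mul_comm]
      _ ≤ Zr r T β := h
  -- combine
  have hZ := Zr_pos r T β
  rw [integral_wilsonMeasure_eq r T]
  have hexp2 : Real.exp (-(β * (ε / 2))) = Real.exp (-(β * (ε / 4))) * Real.exp (-(β * (ε / 4))) := by
    rw [← Real.exp_add]; ring_nf
  have hB0 : 0 ≤ B := (abs_nonneg _).trans (hB 1)
  have hstep1 : (Zr r T β)⁻¹ * ∫ U, Real.exp (-β * wilsonAction r.ρ U) * wilsonAction r.ρ U ∂(haarPi T) ≤
      (Zr r T β)⁻¹ * (ε / 2 * Zr r T β + B * Real.exp (-(β * (ε / 2)))) :=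
    mul_le_mul_of_nonneg_left hnum (inv_nonneg.2 hZ.le)
  have hratio : Real.exp (-(β * (ε / 4))) / Zr r T β ≤ 1 / q := by
    rw [div_le_div_iff₀ hZ hq, one_mul]; exact hden
  have he4 : 0 ≤ B * Real.exp (-(β * (ε / 4))) := by positivity
  have hcancel : (Zr r T β)⁻¹ * (ε / 2 * Zr r T β) = ε / 2 := by field_simp
  calc (Zr r T β)⁻¹ * ∫ U, Real.exp (-β * wilsonAction r.ρ U) * wilsonAction r.ρ U ∂(haarPi T)
      ≤ (Zr r T β)⁻¹ * (ε / 2 * Zr r T β + B * Real.exp (-(β * (ε / 2)))) := hstep1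
    _ = ε / 2 + B * Real.exp (-(β * (ε / 4))) * (Real.exp (-(β * (ε / 4))) / Zr r T β) := by
        rw [mul_add, hcancel, hexp2]; ring
    _ ≤ ε / 2 + B * Real.exp (-(β * (ε / 4))) * (1 / q) := by
        linarith [mul_le_mul_of_nonneg_left hratio he4]
    _ = ε / 2 + B / q * Real.exp (-(β * (ε / 4))) := by ring

/-- **`⟨S_W⟩_β → 0` as `β → ∞`** on every fixed torus (Wilson's measure concentrates on
`{S_W = 0}`). [folklore] -/
theorem tendsto_expect_wilsonAction :
    Tendsto (fun β => ∫ U, wilsonAction r.ρ U ∂(wilsonMeasure (d := 4) (L := T) r.ρ β)) atTop (𝓝 0) := by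
  refine tendsto_order.2 ⟨fun a ha => Eventually.of_forall fun β => ha.trans_le ?_, fun b hb => ?_⟩
  · exact integral_nonneg fun U => wilsonAction_nonneg' (T := T) r U
  · set B := Classical.choose (exists_abs_wilsonAction_le (d := 4) (L := T) r.ρ r.continuous)
    set q := ((haarPi (G := G) T) {U | wilsonAction r.ρ U < b / 4}).toReal
    have htail : Tendsto (fun β : ℝ => B / q * Real.exp (-(β * (b / 4)))) atTop (𝓝 (B / q * 0)) := by
      refine tendsto_const_nhds.mul ?_
      have : Tendsto (fun β : ℝ => -(β * (b / 4))) atTop atBot := by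
        have h := tendsto_id.atTop_mul_const (show 0 < b / 4 by positivity)
        exact tendsto_neg_atTop_atBot.comp h
      exact Real.tendsto_exp_atBot.comp this
    rw [mul_zero] at htail
    have hev : ∀ᶠ β : ℝ in atTop, B / q * Real.exp (-(β * (b / 4))) < b / 2 :=
      htail (Iio_mem_nhds (by positivity))
    filter_upwards [hev, eventually_ge_atTop (0 : ℝ)] with β hβ hβ0
    have h := expect_wilsonAction_le r T hβ0 hb
    linarith

end TorusGibbs

end

end Summit.QuantumFields.YangMills.Theorems.BalabanStepParabolic.Negative
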